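import Summits.Ventures.PercRepro.MatroidIndepCount

/-!
# PercRepro — C-025 «RANK LEVEL-SET INEQUALITY»: (L0), the coloop-free level count (p3, gen 6)

Mine-2's (L0) (`proofs/MINE2-RLS.md` §13): for a loopless, coloop-free matroid `N₀` of rank `p` on `c′` points
and `1 ≤ j ≤ p`, `(p+1)·W_j ≥ C(p+1, j)·c′` with `W_j = #{T ⊆ E : r(T) = j}`. It is the double count of the
pairs `(T, x)` with `r(T) = j` and `x` a coloop of `N₀|T` (`x ∈ T`, `x ∉ cl(T ∖ {x})`): every such `T` has at
most `j` coloops (they lie in every basis of `T`, `coloops_restrict_subset_isBasis`), and for every `x` the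
sets `T′ ⊆ E ∖ {x}` with `r(T′) = j − 1` and `x ∉ cl(T′)` give distinct such `T = T′ ∪ {x}` — at least
`C(p, j − 1)` of them by typer-2's `lemmaP` (`MatroidIndepCount.lean`). So `j·W_j ≥ c′·C(p, j−1)` and
`(p+1)·C(p, j−1) = j·C(p+1, j)`.

* `coloops_restrict_subset_isBasis` — the coloops of `M|T` lie in every basis of `T`;
* `card_coloopsIn_le` — a rank-`j` set has at most `j` such elements;
* `choose_le_card_witnesses` — at least `C(p, j−1)` rank-`j` sets `T` with `x` a coloop of `M|T`;
* **`L0`** — the inequality `C(p+1, j) · |E| ≤ (p+1) · W_j` (in `ℕ`).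
Hypotheses: `[M.Finite]`, no coloops, no loops (every `{e}` independent), `M.eRank = p`, `1 ≤ j ≤ p`.
Axioms: standard.
-/

namespace PercRepro

open Set Finset
open scoped Matroid

variable {α : Type} {M : Matroid α}

/-- An element of `T` outside the closure of `T ∖ {x}` lies in every basis of `T`. -/
lemma mem_isBasis_of_notMem_closure_sdiff {T I : Set α} {x : α} (hI : M.IsBasis I T) (hxT : x ∈ T)
    (hx : x ∉ M.closure (T \ {x})) : x ∈ I := by
  by_contra hxI
  have hIT : I ⊆ T \ {x} := fun y hy => ⟨hI.subset hy, fun hyx => hxI (by rwa [mem_singleton_iff.1 hyx] at hy)⟩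
  exact hx (M.closure_subset_closure hIT (hI.subset_closure hxT))

/-- A subset of `E` of rank `j` has at most `j` elements `x` with `x ∉ cl(T ∖ {x})`. -/
lemma ncard_coloopsIn_le [M.Finite] {T : Set α} {j : ℕ} (hT : T ⊆ M.E) (hj : M.eRk T = (j : ℕ∞)) :
    {x | x ∈ T ∧ x ∉ M.closure (T \ {x})}.ncard ≤ j := by
  obtain ⟨I, hI⟩ := M.exists_isBasis T hT
  have hIfin : I.Finite := M.set_finite I (hI.subset.trans hT)
  have hIcard : I.ncard = j := by
    have h := hI.encard_eq_eRk
    rw [hj, ← hIfin.cast_ncard_eq] at h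
    exact_mod_cast h
  rw [← hIcard]
  exact ncard_le_ncard (fun x hx => mem_isBasis_of_notMem_closure_sdiff hI hx.1 hx.2) hIfin

/-- **(L0)** (mine-2, MINE2-RLS.md §13): in a loopless, coloop-free finite matroid of rank `p` on `|E|`
points, for `1 ≤ j ≤ p`: `C(p+1, j) · |E| ≤ (p+1) · #{T ⊆ E : r(T) = j}`. -/
theorem L0 [M.Finite] (hcol : ∀ e, ¬ M.IsColoop e) (hloop : ∀ e ∈ M.E, M.Indep {e}) {p : ℕ}
    (hr : M.eRank = p) (j : ℕ) (hj : 1 ≤ j) (hjp : j ≤ p) :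
    (p + 1).choose j * M.E.ncard ≤ (p + 1) * {T : Set α | T ⊆ M.E ∧ M.eRk T = (j : ℕ∞)}.ncard := by
  classical
  have hEfin : M.E.Finite := M.set_finite M.E
  set Ef : Finset α := hEfin.toFinset with hEf
  have hEcard : Ef.card = M.E.ncard := (ncard_eq_toFinset_card _ hEfin).symm
  have hmemEf : ∀ y, y ∈ Ef ↔ y ∈ M.E := fun y => hEfin.mem_toFinset
  -- the rank-`j` subsets of `E` as a Finset of Finsets
  set s : Finset (Finset α) := Ef.powerset.filter (fun T => M.eRk (T : Set α) = (j : ℕ∞)) with hs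
  have hmem_s : ∀ T : Finset α, T ∈ s ↔ (T : Set α) ⊆ M.E ∧ M.eRk (T : Set α) = (j : ℕ∞) := by
    intro T
    rw [hs, Finset.mem_filter, Finset.mem_powerset]
    constructor
    · rintro ⟨h1, h2⟩
      exact ⟨fun y hy => (hmemEf y).1 (h1 hy), h2⟩
    · rintro ⟨h1, h2⟩
      exact ⟨fun y hy => (hmemEf y).2 (h1 hy), h2⟩
  have hscard : s.card = {T : Set α | T ⊆ M.E ∧ M.eRk T = (j : ℕ∞)}.ncard := by
    have himg : {T : Set α | T ⊆ M.E ∧ M.eRk T = (j : ℕ∞)} = (fun T : Finset α => (T : Set α)) '' ↑s := by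
      ext T
      constructor
      · rintro ⟨hTE, hTj⟩
        have hTfin : T.Finite := hEfin.subset hTE
        refine ⟨hTfin.toFinset, ?_, hTfin.coe_toFinset⟩
        rw [Finset.mem_coe, hmem_s, hTfin.coe_toFinset]
        exact ⟨hTE, hTj⟩
      · rintro ⟨T', hT', rfl⟩
        rw [Finset.mem_coe, hmem_s] at hT'
        exact hT'
    rw [himg, ncard_image_of_injective _ Finset.coe_injective, ncard_coe_finset]
  -- the relation: `x` is a coloop of `M | T`
  let r : Finset α → α → Prop := fun T x => x ∈ T ∧ x ∉ M.closure ((T : Set α) \ {x})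
  -- double counting: `Ef.card * C(p, j-1) ≤ s.card * j`
  have hdc : Ef.card * p.choose (j - 1) ≤ s.card * j := by
    refine Finset.card_mul_le_card_mul' r ?_ ?_
    · -- for every `x`: at least `C(p, j-1)` sets `T` of rank `j` with `x` a coloop of `M | T`
      intro x hx
      have hxE : x ∈ M.E := (hmemEf x).1 hx
      have hxind : M.Indep {x} := hloop x hxE
      have hP := Matroid.lemmaP hcol hr hxind (j - 1) (by omega)
      rw [← ncard_coe_finset]
      refine hP.trans (ncard_le_ncard_of_injOn (fun T' => insert x (Ef.filter (· ∈ T'))) ?_ ?_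
        (Finset.finite_toSet _))
      · rintro T' ⟨hT'E, hT'rk, hT'cl⟩
        have hxT' : x ∉ T' := fun h => (hT'E h).2 rfl
        have hcoe : ((insert x (Ef.filter (· ∈ T')) : Finset α) : Set α) = insert x T' := by
          ext y
          simp only [Finset.coe_insert, Finset.coe_filter, Set.mem_insert_iff, Set.mem_setOf_eq,
            hmemEf]
          constructor
          · rintro (h | ⟨-, h⟩)
            · exact Or.inl h
            · exact Or.inr h
          · rintro (h | h)
            · exact Or.inl h
            · exact Or.inr ⟨(hT'E h).1, h⟩
        have hxcl : x ∈ M.E \ M.closure T' := ⟨hxE, hT'cl⟩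
        rw [Finset.mem_coe, Finset.mem_bipartiteBelow, hmem_s]
        refine ⟨⟨?_, ?_⟩, ?_, ?_⟩
        · rw [hcoe]
          exact insert_subset hxE (fun y hy => (hT'E hy).1)
        · rw [hcoe, Matroid.eRk_insert_eq_add_one hxcl, hT'rk]
          have : j - 1 + 1 = j := by omega
          exact_mod_cast this
        · exact Finset.mem_insert_self x _
        · show x ∉ M.closure (((insert x (Ef.filter (· ∈ T')) : Finset α) : Set α) \ {x})
          rw [hcoe, Set.insert_sdiff_of_mem _ (Set.mem_singleton x), Set.sdiff_singleton_eq_self hxT']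
          exact hT'cl
      · rintro T' ⟨hT'E, -, -⟩ T'' ⟨hT''E, -, -⟩ hEq
        have hxT' : x ∉ T' := fun h => (hT'E h).2 rfl
        have hxT'' : x ∉ T'' := fun h => (hT''E h).2 rfl
        have h := congrArg (fun F : Finset α => ((F : Set α) \ {x})) hEq
        simp only [Finset.coe_insert, Finset.coe_filter, hmemEf] at h
        have e1 : insert x {y | y ∈ M.E ∧ y ∈ T'} \ {x} = T' := by
          rw [Set.insert_sdiff_of_mem _ (Set.mem_singleton x)]
          ext y
          simp only [Set.mem_sdiff, Set.mem_setOf_eq, Set.mem_singleton_iff]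
          constructor
          · rintro ⟨⟨-, h⟩, -⟩; exact h
          · intro h; exact ⟨⟨(hT'E h).1, h⟩, fun hyx => hxT' (hyx ▸ h)⟩
        have e2 : insert x {y | y ∈ M.E ∧ y ∈ T''} \ {x} = T'' := by
          rw [Set.insert_sdiff_of_mem _ (Set.mem_singleton x)]
          ext y
          simp only [Set.mem_sdiff, Set.mem_setOf_eq, Set.mem_singleton_iff]
          constructor
          · rintro ⟨⟨-, h⟩, -⟩; exact h
          · intro h; exact ⟨⟨(hT''E h).1, h⟩, fun hyx => hxT'' (hyx ▸ h)⟩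
        rw [e1, e2] at h
        exact h
    · -- for every rank-`j` set `T`: at most `j` coloops of `M | T`
      intro T hT
      rw [hmem_s] at hT
      have hsub : ((Ef.bipartiteAbove r T : Finset α) : Set α) ⊆
          {x | x ∈ (T : Set α) ∧ x ∉ M.closure ((T : Set α) \ {x})} := by
        intro x hx
        rw [Finset.mem_coe, Finset.mem_bipartiteAbove] at hx
        exact ⟨Finset.mem_coe.2 hx.2.1, hx.2.2⟩
      have hfin : {x | x ∈ (T : Set α) ∧ x ∉ M.closure ((T : Set α) \ {x})}.Finite :=
        (Finset.finite_toSet T).subset (fun x hx => hx.1)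
      calc (Ef.bipartiteAbove r T).card
          = ((Ef.bipartiteAbove r T : Finset α) : Set α).ncard := (ncard_coe_finset _).symm
        _ ≤ {x | x ∈ (T : Set α) ∧ x ∉ M.closure ((T : Set α) \ {x})}.ncard := ncard_le_ncard hsub hfin
        _ ≤ j := ncard_coloopsIn_le hT.1 hT.2
  -- assemble: `(p+1) · C(p, j-1) = C(p+1, j) · j`
  have hchoose : (p + 1) * p.choose (j - 1) = (p + 1).choose j * j := by
    have h := Nat.add_one_mul_choose_eq p (j - 1)
    have : j - 1 + 1 = j := by omega
    rwa [this] at h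
  rw [hEcard] at hdc
  refine Nat.le_of_mul_le_mul_right ?_ hj
  calc (p + 1).choose j * M.E.ncard * j
      = ((p + 1) * p.choose (j - 1)) * M.E.ncard := by rw [hchoose]; ring
    _ = (p + 1) * (M.E.ncard * p.choose (j - 1)) := by ring
    _ ≤ (p + 1) * (s.card * j) := Nat.mul_le_mul_left _ hdc
    _ = (p + 1) * {T : Set α | T ⊆ M.E ∧ M.eRk T = (j : ℕ∞)}.ncard * j := by rw [hscard]; ring

end PercRepro
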